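import Literature.NumberTheory.Sieve.BombieriFriedlanderIwaniecPieces
import Literature.NumberTheory.Sieve.BombieriFriedlanderIwaniecBilinear
import HarnessLib

/-!
# Bombieri–Friedlander–Iwaniec 1986: a sieved box as the smooth variable (the fundamental lemma per modulus)

Topic `Literature/NumberTheory/Sieve`, companion to
`Literature.NumberTheory.Sieve.BombieriFriedlanderIwaniecBilinear` (the bilinear discrepancy
`Literature.NumberTheory.Sieve.BFI.bilinDisc`) and
`Literature.NumberTheory.Sieve.RoughNumbersCoprimeProgressions` (the fundamental-lemma bound
`roughCountCop_disc_le` for `z`-rough integers in a segment of a reduced class).  Everything here is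
PROVED (from the named fact `Literature.NumberTheory.Sieve.SieveSequence.fundamental_lemma_uniform`).

In the assembly of BFI Theorem 10 along §§15, 17, a sieved, boxed Heath-Brown piece `α ⋆ β` one of
whose SMOOTH variables has size `M ≥ x^{1−ε₁}` cannot be fed to Theorem 5* (hypothesis (A₁),
`N ≥ x^ε`, fails).  Such a piece is trivial in another way: for each modulus `q` and each `n`
coprime to `q`, the inner bracket `∑_{m∼M, mn≡a (q)} α_m − φ(q)⁻¹ ∑_{m∼M, (mn,q)=1} α_m` of
`Δ_{α⋆β}(q)` is the sieve discrepancy of the `z`-rough integers of the box in the class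
`a n̄ (mod q)`, which the fundamental lemma (BFI Lemma 4, p. 211; as used for the almost-prime
variable on p. 238) bounds by `τ(q)² (M/q · e^{−log D'/log z} + D')` with `D' = x^{1/7}`:

* `Literature.NumberTheory.Sieve.BFI.sum_dyadic_congr_roughBox_eq`,
  `Literature.NumberTheory.Sieve.BFI.sum_dyadic_coprime_roughBox_eq` — the two inner sums of the
  box indicator `1_{(P,P']} · 1_{(·,P(z))=1}` as the counting functions `roughCountCop`;
* `Literature.NumberTheory.Sieve.BFI.bilinDisc_eq_sum_mul_inner` — `Δ_{α⋆β}(q) = ∑_n β_n I(n,q)`;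
* `Literature.NumberTheory.Sieve.BFI.sum_abs_bilinDisc_roughBox_le` — the resulting bound
  `∑_{q ≤ D, (q,a)=1} |Δ_{F⋆G}(q)| ≤ C ‖G‖₁ (M e^{−log x^{1/7}/log z} + x^{1/7}(D + 2)) (log x)^8`.

## References

* E. Bombieri, J. B. Friedlander, H. Iwaniec, *Primes in arithmetic progressions to large moduli*,
  Acta Math. 156 (1986), 203–251, §2 Lemma 4 p. 211, §12 p. 238. [BombieriFriedlanderIwaniecActa1986]
* J. Friedlander, H. Iwaniec, *Opera de Cribro*, AMS Coll. Publ. 57 (2010), Cor. 6.10.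
  [FriedlanderIwaniecOpera2010]
-/

open Finset Real
open scoped ArithmeticFunction.sigma

namespace Literature.NumberTheory.Sieve

namespace BFI

/-! ### The inner sums of a sieved box indicator -/

section RoughBox

variable {z M P P' : ℝ} {F : ℕ → ℝ}

/-- Membership in the box `(P, P']` versus the integer segment `(⌊P⌋, ⌊P'⌋]` (`P ≥ 0`). [folklore] -/
theorem mem_Ioc_floor_iff (hP : 0 ≤ P) (hPP' : P ≤ P') {m : ℕ} :
    m ∈ Ioc ⌊P⌋₊ ⌊P'⌋₊ ↔ P < m ∧ (m : ℝ) ≤ P' := by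
  rw [Finset.mem_Ioc, Nat.floor_lt hP, Nat.le_floor_iff (hP.trans hPP')]

/-- The congruence sum of the sieved box indicator against a unit `n` is a `roughCountCop`:
for `F = 1_{(P,P']} · 1_{(·,P(z))=1}` on `m ∼ M ⊇ (P, P']`, `q ≥ 1` and `n` invertible mod `q`,
`∑_{m∼M, mn ≡ a (q)} F(m) = #{⌊P⌋ < m ≤ ⌊P'⌋ : m ≡ a n̄ (q), (m, P(z)) = 1}`. [folklore] -/
theorem sum_dyadic_congr_roughBox_eq (hM : 0 ≤ M) (hMP : M ≤ P) (hPP' : P ≤ P') (hP'M : P' ≤ 2 * M)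
    (hF : ∀ m ∈ dyadic M, F m = if P < m ∧ (m : ℝ) ≤ P' then (if IsRough z m then 1 else 0) else 0)
    {q : ℕ} [NeZero q] {n : ℕ} (hn : IsUnit ((n : ZMod q))) (a : ℤ) :
    (∑ m ∈ dyadic M, if ((m * n : ℕ) : ZMod q) = (a : ZMod q) then F m else 0) =
      (roughCountCop ⌊P⌋₊ ⌊P'⌋₊ q ((a : ZMod q) * (hn.unit⁻¹ : (ZMod q)ˣ)) 1 z : ℝ) := by
  unfold roughCountCop
  rw [Finset.card_eq_sum_ones, Nat.cast_sum, Finset.sum_filter]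
  simp only [Nat.cast_one]
  -- rewrite the left side as an indicator sum
  have hL : ∀ m ∈ dyadic M, (if ((m * n : ℕ) : ZMod q) = (a : ZMod q) then F m else 0) =
      if (m : ZMod q) = (a : ZMod q) * (hn.unit⁻¹ : (ZMod q)ˣ) ∧ m.Coprime 1 ∧
        m.Coprime (primesProdBelow z) then (if P < m ∧ (m : ℝ) ≤ P' then (1 : ℝ) else 0) else 0 := by
    intro m hm
    have hm0 : m ≠ 0 := (pos_of_mem_dyadic hM hm).ne'
    have hcong : ((m * n : ℕ) : ZMod q) = (a : ZMod q) ↔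
        (m : ZMod q) = (a : ZMod q) * (hn.unit⁻¹ : (ZMod q)ˣ) := by
      rw [Nat.cast_mul]
      constructor
      · intro h; rw [← h, mul_assoc, IsUnit.mul_val_inv, mul_one]
      · intro h; rw [h, mul_assoc, IsUnit.val_inv_mul, mul_one]
    rw [hF m hm]
    by_cases h3 : P < (m : ℝ) ∧ (m : ℝ) ≤ P'
    · by_cases h2 : IsRough z m
      · have h2' := (isRough_iff_coprime_primesProdBelow hm0).1 h2
        by_cases h1 : (m : ZMod q) = (a : ZMod q) * (hn.unit⁻¹ : (ZMod q)ˣ)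
        · rw [if_pos (hcong.2 h1), if_pos h3, if_pos h2, if_pos ⟨h1, Nat.coprime_one_right _, h2'⟩,
            if_pos h3]
        · rw [if_neg (fun h => h1 (hcong.1 h)), if_neg (fun h => h1 h.1)]
      · have h2' : ¬ m.Coprime (primesProdBelow z) :=
          fun h => h2 ((isRough_iff_coprime_primesProdBelow hm0).2 h)
        rw [if_neg (show ¬((m : ZMod q) = (a : ZMod q) * (hn.unit⁻¹ : (ZMod q)ˣ) ∧ m.Coprime 1 ∧
            m.Coprime (primesProdBelow z)) from fun h => h2' h.2.2), if_pos h3, if_neg h2]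
        split_ifs <;> rfl
    · rw [if_neg h3, if_neg h3]
      split_ifs <;> rfl
  rw [Finset.sum_congr rfl hL]
  -- both sides are sums of the same indicator over sets containing its support
  rw [← Finset.sum_filter, ← Finset.sum_filter, ← Finset.sum_filter]
  refine Finset.sum_congr ?_ fun _ _ => rfl
  ext m
  simp only [Finset.mem_filter, mem_dyadic hM, mem_Ioc_floor_iff (hM.trans hMP) hPP']
  constructor
  · rintro ⟨⟨-, h2⟩, h3⟩; exact ⟨h3, h2⟩
  · rintro ⟨h1, h2⟩; exact ⟨⟨⟨by linarith [h1.1], by linarith [h1.2]⟩, h2⟩, h1⟩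

/-- The coprimality sum of the sieved box indicator: for `(n, q) = 1`,
`∑_{m∼M, (mn,q)=1} F(m) = #{⌊P⌋ < m ≤ ⌊P'⌋ : (m, q) = 1, (m, P(z)) = 1}`. [folklore] -/
theorem sum_dyadic_coprime_roughBox_eq (hM : 0 ≤ M) (hMP : M ≤ P) (hPP' : P ≤ P') (hP'M : P' ≤ 2 * M)
    (hF : ∀ m ∈ dyadic M, F m = if P < m ∧ (m : ℝ) ≤ P' then (if IsRough z m then 1 else 0) else 0)
    {q n : ℕ} (hn : n.Coprime q) :
    (∑ m ∈ dyadic M, if (m * n).Coprime q then F m else 0) =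
      (roughCountCop ⌊P⌋₊ ⌊P'⌋₊ 1 0 (1 * q) z : ℝ) := by
  unfold roughCountCop
  rw [Finset.card_eq_sum_ones, Nat.cast_sum, Finset.sum_filter, one_mul]
  simp only [Nat.cast_one]
  have hL : ∀ m ∈ dyadic M, (if (m * n).Coprime q then F m else 0) =
      if (m : ZMod 1) = 0 ∧ m.Coprime q ∧ m.Coprime (primesProdBelow z) then
        (if P < m ∧ (m : ℝ) ≤ P' then (1 : ℝ) else 0) else 0 := by
    intro m hm
    have hm0 : m ≠ 0 := (pos_of_mem_dyadic hM hm).ne'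
    have hcop : (m * n).Coprime q ↔ m.Coprime q :=
      ⟨fun h => Nat.Coprime.coprime_mul_right h, fun h => Nat.Coprime.mul_left h hn⟩
    rw [hF m hm]
    have h0 : (m : ZMod 1) = 0 := Subsingleton.elim _ _
    by_cases h3 : P < (m : ℝ) ∧ (m : ℝ) ≤ P'
    · by_cases h2 : IsRough z m
      · have h2' := (isRough_iff_coprime_primesProdBelow hm0).1 h2
        by_cases h1 : m.Coprime q
        · rw [if_pos (hcop.2 h1), if_pos h3, if_pos h2, if_pos ⟨h0, h1, h2'⟩, if_pos h3]
        · rw [if_neg (fun h => h1 (hcop.1 h)), if_neg (fun h => h1 h.2.1)]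
      · have h2' : ¬ m.Coprime (primesProdBelow z) :=
          fun h => h2 ((isRough_iff_coprime_primesProdBelow hm0).2 h)
        rw [if_neg (show ¬((m : ZMod 1) = 0 ∧ m.Coprime q ∧ m.Coprime (primesProdBelow z)) from
            fun h => h2' h.2.2), if_pos h3, if_neg h2]
        split_ifs <;> rfl
    · rw [if_neg h3, if_neg h3]
      split_ifs <;> rfl
  rw [Finset.sum_congr rfl hL]
  rw [← Finset.sum_filter, ← Finset.sum_filter, ← Finset.sum_filter]
  refine Finset.sum_congr ?_ fun _ _ => rfl
  ext m
  simp only [Finset.mem_filter, mem_dyadic hM, mem_Ioc_floor_iff (hM.trans hMP) hPP']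
  constructor
  · rintro ⟨⟨-, h2⟩, h3⟩; exact ⟨h3, h2⟩
  · rintro ⟨h1, h2⟩; exact ⟨⟨⟨by linarith [h1.1], by linarith [h1.2]⟩, h2⟩, h1⟩

end RoughBox

/-! ### The bound per modulus, summed -/

/-- `bilinDisc` is linear in `β`: `Δ_{α⋆β}(q) = ∑_{n∼N} β_n · I(n, q)` with the inner bracket
`I(n,q) = ∑_{m∼M, mn≡a (q)} α_m − φ(q)⁻¹ ∑_{m∼M, (mn,q)=1} α_m`. [folklore] -/
theorem bilinDisc_eq_sum_mul_inner (a : ℤ) (M N : ℝ) (α β : ℕ → ℝ) (q : ℕ) :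
    bilinDisc a M N α β q = ∑ n ∈ dyadic N, β n *
      ((∑ m ∈ dyadic M, if ((m * n : ℕ) : ZMod q) = (a : ZMod q) then α m else 0) -
        (∑ m ∈ dyadic M, if (m * n).Coprime q then α m else 0) / (Nat.totient q : ℝ)) := by
  unfold bilinDisc
  rw [Finset.sum_comm, Finset.sum_comm (s := dyadic M), Finset.sum_div, ← Finset.sum_sub_distrib]
  refine Finset.sum_congr rfl fun n _ => ?_
  rw [mul_sub, mul_div_assoc', Finset.mul_sum, Finset.mul_sum]
  congr 1
  · exact Finset.sum_congr rfl fun m _ => by split_ifs <;> ring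
  · congr 1
    exact Finset.sum_congr rfl fun m _ => by split_ifs <;> ring

/-- **A sieved box as the smooth variable: the fundamental lemma per modulus** (the case of a
Heath-Brown piece one of whose smooth variables exceeds `x^{1−ε}`; BFI §12 p. 238 treat such an
almost-prime variable by the fundamental lemma, Lemma 4 p. 211).  Let `F = 1_{(P,P']} · 1_{(·,P(z))=1}`
on `m ∼ M` with `M ≤ P ≤ P' ≤ 2M`, `M ≥ 1`, let `G` be any coefficients on `n ∼ N`, `2 ≤ z ≤ x^{1/7}`
and `Dn ≤ x`.  Then
`∑_{q ≤ Dn, (q,a)=1} |Δ_{F⋆G}(q)| ≤ C ‖G‖₁ (M e^{−log x^{1/7}/log z} + x^{1/7} (Dn + 2)) (log x)^8`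
with `C` depending only on the fundamental-lemma constant: for each `n` coprime to `q` the inner
bracket is the sieve discrepancy `Literature.NumberTheory.Sieve.BFI.roughCountCop_disc_le` of the
segment `(⌊P⌋, ⌊P'⌋]` in the class `a n̄ (mod q)` (level `x^{1/7}`), and it vanishes otherwise.
[cite: BombieriFriedlanderIwaniecActa1986, §12 p. 238; §2 Lemma 4 p. 211] -/
theorem sum_abs_bilinDisc_roughBox_le (hFL : SieveSequence.fundamental_lemma_uniform) (a : ℤ) :
    ∃ C : ℝ, 0 ≤ C ∧ ∀ (x z M N P P' : ℝ) (F G : ℕ → ℝ) (Dn : ℕ),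
      2 ≤ x → 2 ≤ z → z ≤ x ^ (1 / 7 : ℝ) → 1 ≤ M → M ≤ P → P ≤ P' → P' ≤ 2 * M → 0 ≤ N →
      (Dn : ℝ) ≤ x →
      (∀ m ∈ dyadic M, F m = if P < m ∧ (m : ℝ) ≤ P' then (if IsRough z m then 1 else 0) else 0) →
      ∑ q ∈ (Icc 1 Dn).filter (fun q : ℕ => IsCoprime (q : ℤ) a), |bilinDisc a M N F G q| ≤
        C * (∑ n ∈ dyadic N, |G n|) *
          (M * Real.exp (-(Real.log (x ^ (1 / 7 : ℝ)) / Real.log z)) + x ^ (1 / 7 : ℝ) * (Dn + 2)) *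
            Real.log x ^ 8 := by
  obtain ⟨C₀, hC₀, hdisc⟩ := roughCountCop_disc_le hFL
  obtain ⟨C₃, hC₃, h₃⟩ := exists_sum_sigma_zero_pow_div_le_real 2
  obtain ⟨C₄, hC₄, h₄⟩ := exists_sum_sigma_zero_pow_le_real 2
  refine ⟨4 * C₀ * C₃ + 2 * (C₀ + 2) * C₄ * 2 ^ 8, by positivity,
    fun x z M N P P' F G Dn hx hz hzx hM hMP hPP' hP'M hN hDn hF => ?_⟩
  have hx0 : 0 < x := by linarith
  have hM0 : 0 ≤ M := by linarith
  set D' : ℝ := x ^ (1 / 7 : ℝ) with hD'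
  set e : ℝ := Real.exp (-(Real.log D' / Real.log z)) with he
  have he0 : 0 ≤ e := (Real.exp_pos _).le
  have hD'1 : 1 ≤ D' := Real.one_le_rpow (by linarith) (by norm_num)
  have hL0 : 0 ≤ Real.log x := Real.log_nonneg (by linarith)
  -- the bound for one inner bracket
  set bnd : ℕ → ℝ := fun q => 2 * (σ 0 q : ℝ) ^ 2 * (C₀ * (2 * M / q) * e + C₀ + D' + 1) with hbnd
  have hinner : ∀ q ∈ (Icc 1 Dn).filter (fun q : ℕ => IsCoprime (q : ℤ) a), ∀ n ∈ dyadic N,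
      |(∑ m ∈ dyadic M, if ((m * n : ℕ) : ZMod q) = (a : ZMod q) then F m else 0) -
        (∑ m ∈ dyadic M, if (m * n).Coprime q then F m else 0) / (Nat.totient q : ℝ)| ≤ bnd q := by
    intro q hq n hn
    rw [Finset.mem_filter, Finset.mem_Icc] at hq
    have hq0 : 0 < q := hq.1.1
    haveI : NeZero q := ⟨hq0.ne'⟩
    have hbnd0 : 0 ≤ bnd q := by simp only [hbnd]; positivity
    by_cases hnq : n.Coprime q
    · have hnu : IsUnit ((n : ZMod q)) := (ZMod.isUnit_iff_coprime n q).2 hnq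
      rw [sum_dyadic_congr_roughBox_eq hM0 hMP hPP' hP'M hF hnu a,
        sum_dyadic_coprime_roughBox_eq hM0 hMP hPP' hP'M hF hnq]
      have hau : IsUnit ((a : ZMod q)) := (ZMod.coe_int_isUnit_iff_isCoprime a q).2 hq.2
      have hru : IsUnit ((a : ZMod q) * (hnu.unit⁻¹ : (ZMod q)ˣ)) := hau.mul (Units.isUnit _)
      have h := hdisc q hq0 _ hru 1 one_ne_zero ⌊P⌋₊ ⌊P'⌋₊ (Nat.floor_mono hPP') z D' hz hzx
      have hσ1 : ((σ 0 1 : ℕ) : ℝ) = 1 := by simp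
      rw [hσ1] at h
      refine h.trans ?_
      simp only [hbnd]
      have hX : ((⌊P'⌋₊ : ℝ) - (⌊P⌋₊ : ℝ)) / q ≤ 2 * M / q := by
        refine div_le_div_of_nonneg_right ?_ (Nat.cast_nonneg _)
        have h1 : (⌊P'⌋₊ : ℝ) ≤ P' := Nat.floor_le (by linarith)
        have h2 : P - 1 < (⌊P⌋₊ : ℝ) := by
          have := Nat.lt_floor_add_one P; linarith
        linarith
      have : C₀ * (((⌊P'⌋₊ : ℝ) - (⌊P⌋₊ : ℝ)) / q) * e ≤ C₀ * (2 * M / q) * e :=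
        mul_le_mul_of_nonneg_right (mul_le_mul_of_nonneg_left hX hC₀.le) he0
      nlinarith [sq_nonneg ((σ 0 q : ℝ))]
    · have h1 : (∑ m ∈ dyadic M, if ((m * n : ℕ) : ZMod q) = (a : ZMod q) then F m else 0) = 0 := by
        refine Finset.sum_eq_zero fun m _ => ?_
        rw [if_neg]
        intro h
        rw [mul_comm] at h
        exact hnq (coprime_of_natCast_mul_eq hq.2 h).symm
      have h2 : (∑ m ∈ dyadic M, if (m * n).Coprime q then F m else 0) = 0 := by
        refine Finset.sum_eq_zero fun m _ => ?_
        rw [if_neg]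
        exact fun h => hnq (Nat.Coprime.coprime_mul_left h)
      rw [h1, h2, zero_div, sub_zero, abs_zero]
      exact hbnd0
  -- sum over `q` of the brackets, weighted by `|G|`
  have hstep : ∑ q ∈ (Icc 1 Dn).filter (fun q : ℕ => IsCoprime (q : ℤ) a), |bilinDisc a M N F G q| ≤
      (∑ n ∈ dyadic N, |G n|) * ∑ q ∈ Icc 1 Dn, bnd q := by
    calc _ ≤ ∑ q ∈ (Icc 1 Dn).filter (fun q : ℕ => IsCoprime (q : ℤ) a),
          ∑ n ∈ dyadic N, |G n| * bnd q := by
          refine Finset.sum_le_sum fun q hq => ?_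
          rw [bilinDisc_eq_sum_mul_inner]
          refine (Finset.abs_sum_le_sum_abs _ _).trans (Finset.sum_le_sum fun n hn => ?_)
          rw [abs_mul]
          exact mul_le_mul_of_nonneg_left (hinner q hq n hn) (abs_nonneg _)
      _ = ∑ q ∈ (Icc 1 Dn).filter (fun q : ℕ => IsCoprime (q : ℤ) a),
          (∑ n ∈ dyadic N, |G n|) * bnd q := by
          refine Finset.sum_congr rfl fun q _ => by rw [Finset.sum_mul]
      _ ≤ ∑ q ∈ Icc 1 Dn, (∑ n ∈ dyadic N, |G n|) * bnd q := by
          refine Finset.sum_le_sum_of_subset_of_nonneg (Finset.filter_subset _ _) fun q _ _ => ?_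
          exact mul_nonneg (Finset.sum_nonneg fun _ _ => abs_nonneg _) (by simp only [hbnd]; positivity)
      _ = _ := by rw [← Finset.mul_sum]
  -- the divisor sums
  have hx1 : (1 : ℝ) ≤ x := by linarith
  have hDnx : Dn ≤ ⌊x⌋₊ := Nat.le_floor hDn
  have hA : ∑ q ∈ Icc 1 Dn, (σ 0 q : ℝ) ^ 2 / q ≤ C₃ * Real.log x ^ 8 := by
    have h := h₃ x hx
    norm_num at h
    exact le_trans (Finset.sum_le_sum_of_subset_of_nonneg (Finset.Icc_subset_Icc le_rfl hDnx)
      fun _ _ _ => by positivity) h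
  have hB : ∑ q ∈ Icc 1 Dn, (σ 0 q : ℝ) ^ 2 ≤ C₄ * 2 ^ 8 * (Dn + 2) * Real.log x ^ 8 := by
    have h := h₄ ((Dn : ℝ) + 2) (by linarith)
    norm_num at h
    have hsub : Icc 1 Dn ⊆ Icc 1 ⌊(Dn : ℝ) + 2⌋₊ :=
      Finset.Icc_subset_Icc le_rfl (Nat.le_floor (by linarith))
    have hlog : Real.log ((Dn : ℝ) + 2) ≤ 2 * Real.log x := by
      have h1 : (Dn : ℝ) + 2 ≤ x ^ 2 := by nlinarith
      calc Real.log ((Dn : ℝ) + 2) ≤ Real.log (x ^ 2) := Real.log_le_log (by positivity) h1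
        _ = 2 * Real.log x := by rw [Real.log_pow]; norm_num
    have hlog0 : 0 ≤ Real.log ((Dn : ℝ) + 2) := Real.log_nonneg (by linarith)
    calc ∑ q ∈ Icc 1 Dn, (σ 0 q : ℝ) ^ 2 ≤ ∑ q ∈ Icc 1 ⌊(Dn : ℝ) + 2⌋₊, (σ 0 q : ℝ) ^ 2 :=
          Finset.sum_le_sum_of_subset_of_nonneg hsub fun _ _ _ => by positivity
      _ ≤ C₄ * ((Dn : ℝ) + 2) * Real.log ((Dn : ℝ) + 2) ^ 8 := h
      _ ≤ C₄ * ((Dn : ℝ) + 2) * (2 * Real.log x) ^ 8 :=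
          mul_le_mul_of_nonneg_left (pow_le_pow_left₀ hlog0 hlog 8) (by positivity)
      _ = C₄ * 2 ^ 8 * (Dn + 2) * Real.log x ^ 8 := by ring
  have hsum : ∑ q ∈ Icc 1 Dn, bnd q ≤
      (4 * C₀ * C₃) * M * e * Real.log x ^ 8 + (2 * (C₀ + 2) * C₄ * 2 ^ 8) * D' * (Dn + 2) * Real.log x ^ 8 := by
    have hexp : ∑ q ∈ Icc 1 Dn, bnd q =
        4 * C₀ * M * e * ∑ q ∈ Icc 1 Dn, (σ 0 q : ℝ) ^ 2 / q +
          2 * (C₀ + D' + 1) * ∑ q ∈ Icc 1 Dn, (σ 0 q : ℝ) ^ 2 := by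
      rw [Finset.mul_sum, Finset.mul_sum, ← Finset.sum_add_distrib]
      refine Finset.sum_congr rfl fun q hq => ?_
      simp only [hbnd]
      ring
    rw [hexp]
    have hC' : 2 * (C₀ + D' + 1) ≤ 2 * (C₀ + 2) * D' := by nlinarith
    calc _ ≤ 4 * C₀ * M * e * (C₃ * Real.log x ^ 8) + 2 * (C₀ + 2) * D' * (C₄ * 2 ^ 8 * (Dn + 2) * Real.log x ^ 8) :=
          add_le_add (mul_le_mul_of_nonneg_left hA (by positivity))
            (mul_le_mul hC' hB (Finset.sum_nonneg fun _ _ => by positivity) (by positivity))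
      _ = _ := by ring
  refine hstep.trans ?_
  have hG0 : 0 ≤ ∑ n ∈ dyadic N, |G n| := Finset.sum_nonneg fun _ _ => abs_nonneg _
  calc (∑ n ∈ dyadic N, |G n|) * ∑ q ∈ Icc 1 Dn, bnd q
      ≤ (∑ n ∈ dyadic N, |G n|) * ((4 * C₀ * C₃) * M * e * Real.log x ^ 8 +
          (2 * (C₀ + 2) * C₄ * 2 ^ 8) * D' * (Dn + 2) * Real.log x ^ 8) :=
        mul_le_mul_of_nonneg_left hsum hG0
    _ ≤ (∑ n ∈ dyadic N, |G n|) * ((4 * C₀ * C₃ + 2 * (C₀ + 2) * C₄ * 2 ^ 8) * M * e * Real.log x ^ 8 +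
          (4 * C₀ * C₃ + 2 * (C₀ + 2) * C₄ * 2 ^ 8) * D' * (Dn + 2) * Real.log x ^ 8) := by
        refine mul_le_mul_of_nonneg_left (add_le_add ?_ ?_) hG0
        · have h0 : 0 ≤ M * e * Real.log x ^ 8 := by positivity
          have h1 : 4 * C₀ * C₃ ≤ 4 * C₀ * C₃ + 2 * (C₀ + 2) * C₄ * 2 ^ 8 := by
            have : 0 ≤ 2 * (C₀ + 2) * C₄ * 2 ^ 8 := by positivity
            linarith
          calc 4 * C₀ * C₃ * M * e * Real.log x ^ 8 = (4 * C₀ * C₃) * (M * e * Real.log x ^ 8) := by ring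
            _ ≤ (4 * C₀ * C₃ + 2 * (C₀ + 2) * C₄ * 2 ^ 8) * (M * e * Real.log x ^ 8) :=
                mul_le_mul_of_nonneg_right h1 h0
            _ = _ := by ring
        · have h0 : 0 ≤ D' * (Dn + 2) * Real.log x ^ 8 := by positivity
          have h1 : 2 * (C₀ + 2) * C₄ * 2 ^ 8 ≤ 4 * C₀ * C₃ + 2 * (C₀ + 2) * C₄ * 2 ^ 8 := by
            have : 0 ≤ 4 * C₀ * C₃ := by positivity
            linarith
          calc 2 * (C₀ + 2) * C₄ * 2 ^ 8 * D' * (Dn + 2) * Real.log x ^ 8 =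
              (2 * (C₀ + 2) * C₄ * 2 ^ 8) * (D' * (Dn + 2) * Real.log x ^ 8) := by ring
            _ ≤ (4 * C₀ * C₃ + 2 * (C₀ + 2) * C₄ * 2 ^ 8) * (D' * (Dn + 2) * Real.log x ^ 8) :=
                mul_le_mul_of_nonneg_right h1 h0
            _ = _ := by ring
    _ = _ := by ring

end BFI

end Literature.NumberTheory.Sieve
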